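import Literature.Probability.RandomPlanarGeometry.SAWLoopErasureKestenRenewalGreenTableHigh
import Literature.Probability.RandomPlanarGeometry.SAWDimensionSuperadditiveStrict
import Literature.Probability.RandomPlanarGeometry.SAWDimensionSuperadditive
import Literature.Probability.RandomPlanarGeometry.SAWMemorySixAllDimensions
import HarnessLib

/-!
# Strict superadditivity of the connective constant in the dimension, for ALL `d₁, d₂ ≥ 1`

Topic `Literature/Probability/RandomPlanarGeometry`; a corollary leaf (CLASS D) over
`SAWDimensionSuperadditiveStrict` (`two_mul_sub_two_lt_connectiveConstant : 2d − 2 < μ(ℤ^d)` for `d ≥ 22`, from the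
closed-form renewal floor, and `connectiveConstant_strictSuperadditive_small` for `(1,1), (1,2), (2,2)`; its HONEST SCOPE:
"the pairs with `4 ≤ d₁ + d₂ ≤ 21` are undecided here — they need sharper floors `μ(ℤ⁴), μ(ℤ⁵), …`"),
`SAWLoopErasureKestenRenewalGreenTableHigh` (exactly those floors: `two_mul_sub_two_lt_connectiveConstant_of_le :
2d − 2 < μ(ℤ^d)` for `4 ≤ d ≤ 21`, from kernel-certified Green-function enclosures in the Hara–Slade–Sokal `(0,1)` bound)
and `SAWDimensionSuperadditive` (`connectiveConstant_one : μ(ℤ¹) = 1`; the soft law `μ(d₁) + μ(d₂) ≤ μ(d₁+d₂)`).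

## What is typed (standard axioms; no `sorry`; no computation in this file)

* `two_mul_sub_two_lt_connectiveConstant_of_two_le (hd : 2 ≤ d) : 2d − 2 < μ(ℤ^d)` — all `d ≥ 2` (`d = 2`:
  `μ(ℤ²) ≥ 5/2`; `d = 3`: `μ(ℤ³) > 73/18`; `4 ≤ d ≤ 21`: the Green table; `d ≥ 22`: the closed form);
* **`connectiveConstant_strictSuperadditive (h₁ : 1 ≤ d₁) (h₂ : 1 ≤ d₂) : μ(ℤ^{d₁}) + μ(ℤ^{d₂}) < μ(ℤ^{d₁+d₂})`** —
  from `μ(ℤ^{dᵢ}) ≤ 2dᵢ − 1` ([BDGS2012] (1.13), `BDGS2012_connectiveConstant_bounds_holds`) and the previous item at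
  `d = d₁ + d₂ ≥ 2`;
* `connectiveConstant_add_one_lt (hd : 1 ≤ d) : μ(ℤ^d) + 1 < μ(ℤ^{d+1})` — the strict form of the tree's
  `connectiveConstant_add_one_le` (`SAWDimensionGap`), all `d ≥ 1`; and the squeeze
  `one_lt_connectiveConstant_succ_sub_and_lt_three (hd : 1 ≤ d) : 1 < μ(ℤ^{d+1}) − μ(ℤ^d) < 3`;
* `connectiveConstant_mem_Ioo (hd : 2 ≤ d) : μ(ℤ^d) ∈ (2d − 2, 2d − 1 − 1/(2d))` (upper end: the tree's
  `connectiveConstant_lt_twoTerm`, `SAWMemorySixAllDimensions`) and **`int_floor_connectiveConstant (hd : 2 ≤ d) :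
  ⌊μ(ℤ^d)⌋ = 2d − 2`** — the integer part of the connective constant of `ℤ^d` is `2d − 2` for every `d ≥ 2`
  (`⌊μ(ℤ¹)⌋ = 1`).

Sources: [BDGS2012] = Bauerschmidt–Duminil-Copin–Goodman–Slade, *Lectures on self-avoiding walks*, Clay Math. Proc. 15
(2012), §1.3 (1.13) `d ≤ μ(ℤ^d) ≤ 2d − 1`; [HSS93] = Hara–Slade–Sokal, J. Stat. Phys. 72 (1993), (2.32)–(2.33) and Table 2
(the `(0,1)` lower bounds, `> 2d − 2` from `d = 4` on).  HONEST SCOPE: a forty-line gluing of three landed inputs; the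
mathematics (strict superadditivity of `d ↦ μ(ℤ^d)` on `ℕ_{≥1}`) is, to our knowledge, not stated in print in this
form, but it is an immediate consequence of the printed bounds `2d − 2 < μ(ℤ^d) ≤ 2d − 1` once the former is available
for every `d ≥ 2`, which is what the Green table completes.
-/

namespace Literature.Probability.RandomPlanarGeometry.SAW.Zd

/-- **`2d − 2 < μ(ℤ^d)` for every `d ≥ 2`.**
[cite: HaraSladeSokal1993, (2.32)–(2.33) p. 11 & Table 2 p. 14 row (0,1) (d ≥ 4); BDGS2012, §1.3 (1.14) (μ(ℤ²) ≥ 2.62)] -/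
theorem two_mul_sub_two_lt_connectiveConstant_of_two_le {d : ℕ} (hd : 2 ≤ d) :
    2 * (d : ℝ) - 2 < connectiveConstant d := by
  rcases (show d = 2 ∨ d = 3 ∨ (4 ≤ d ∧ d ≤ 21) ∨ 22 ≤ d by omega) with rfl | rfl | ⟨h4, h21⟩ | h22
  · have h := le_connectiveConstant_two_25
    push_cast
    linarith
  · have h := connectiveConstant_three_gt_std
    push_cast
    linarith
  · exact LoopErasure.two_mul_sub_two_lt_connectiveConstant_of_le h4 h21
  · exact two_mul_sub_two_lt_connectiveConstant h22

/-- **Strict superadditivity of the connective constant in the dimension**: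
`μ(ℤ^{d₁}) + μ(ℤ^{d₂}) < μ(ℤ^{d₁+d₂})` for all `d₁, d₂ ≥ 1` (from `μ(ℤ^{dᵢ}) ≤ 2dᵢ − 1` and `2(d₁+d₂) − 2 < μ(ℤ^{d₁+d₂})`).
[cite: BDGS2012, §1.3 (1.13) (d ≤ μ ≤ 2d − 1); HaraSladeSokal1993, Table 2 p. 14 row (0,1)] -/
theorem connectiveConstant_strictSuperadditive {d₁ d₂ : ℕ} (h₁ : 1 ≤ d₁) (h₂ : 1 ≤ d₂) :
    connectiveConstant d₁ + connectiveConstant d₂ < connectiveConstant (d₁ + d₂) := by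
  have u₁ := (BDGS2012_connectiveConstant_bounds_holds d₁ h₁).2
  have u₂ := (BDGS2012_connectiveConstant_bounds_holds d₂ h₂).2
  have h := two_mul_sub_two_lt_connectiveConstant_of_two_le (d := d₁ + d₂) (by omega)
  push_cast at h
  linarith

/-- **`μ(ℤ^d) + 1 < μ(ℤ^{d+1})` for every `d ≥ 1`** (strict form of `connectiveConstant_add_one_le`; `μ(ℤ¹) = 1`).
[cite: BDGS2012, §1.3 (1.13); HaraSladeSokal1993, Table 2 p. 14 row (0,1)] -/
theorem connectiveConstant_add_one_lt {d : ℕ} (hd : 1 ≤ d) :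
    connectiveConstant d + 1 < connectiveConstant (d + 1) := by
  have h := connectiveConstant_strictSuperadditive hd (le_refl 1)
  rwa [connectiveConstant_one] at h

/-- **The dimension gap is squeezed: `1 < μ(ℤ^{d+1}) − μ(ℤ^d) < 3` for every `d ≥ 1`** (upper half: `μ(ℤ^{d+1}) ≤ 2d + 1`
and `μ(ℤ^d) > 2d − 2` for `d ≥ 2`, `μ(ℤ²) ≤ 3 = μ(ℤ¹) + 2` at `d = 1`; the `1/d` expansion gives gap `→ 2`).
[cite: BDGS2012, §1.3 (1.13) (μ(ℤ^d) ≤ 2d − 1); HaraSladeSokal1993, Table 2 p. 14 row (0,1)] -/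
theorem one_lt_connectiveConstant_succ_sub_and_lt_three {d : ℕ} (hd : 1 ≤ d) :
    1 < connectiveConstant (d + 1) - connectiveConstant d ∧ connectiveConstant (d + 1) - connectiveConstant d < 3 := by
  refine ⟨by linarith [connectiveConstant_add_one_lt hd], ?_⟩
  have u := (BDGS2012_connectiveConstant_bounds_holds (d + 1) (by omega)).2
  push_cast at u
  rcases (show d = 1 ∨ 2 ≤ d by omega) with rfl | h2
  · rw [connectiveConstant_one]
    norm_num at u ⊢
    linarith
  · have l := two_mul_sub_two_lt_connectiveConstant_of_two_le h2
    linarith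

/-- **Sandwich**: `2d − 2 < μ(ℤ^d) < 2d − 1 − 1/(2d)` for every `d ≥ 2` (upper end: the tree's memory-six bound
`connectiveConstant_lt_twoTerm`). [cite: HaraSladeSokal1993, Table 2 p. 14 row (0,1); BDGS2012, §1.3 (1.13)] -/
theorem connectiveConstant_mem_Ioo {d : ℕ} (hd : 2 ≤ d) :
    connectiveConstant d ∈ Set.Ioo (2 * (d : ℝ) - 2) (2 * d - 1 - 1 / (2 * (d : ℝ))) :=
  ⟨two_mul_sub_two_lt_connectiveConstant_of_two_le hd, connectiveConstant_lt_twoTerm hd⟩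

/-- **The integer part of the connective constant of `ℤ^d` is `2d − 2`** for every `d ≥ 2` (`μ(ℤ²) ∈ (2.5, 2.75)`,
`μ(ℤ³) ∈ (4.44, 4.76)`, `μ(ℤ⁴) ∈ (6.70, 6.86)`, …; `⌊μ(ℤ¹)⌋ = 1`).
[cite: HaraSladeSokal1993, Table 2 p. 14 row (0,1); BDGS2012, §1.3 (1.13)] -/
theorem int_floor_connectiveConstant {d : ℕ} (hd : 2 ≤ d) : ⌊connectiveConstant d⌋ = 2 * (d : ℤ) - 2 := by
  rw [Int.floor_eq_iff]
  have h₁ := two_mul_sub_two_lt_connectiveConstant_of_two_le hd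
  have h₂ := connectiveConstant_lt_twoTerm hd
  have hd' : (0 : ℝ) < 2 * (d : ℝ) := by positivity
  have h₃ : 0 < 1 / (2 * (d : ℝ)) := by positivity
  push_cast
  constructor <;> linarith

end Literature.Probability.RandomPlanarGeometry.SAW.Zd
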